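import Summits.AtomisticToContinuum.FouriersLaw.Theses.ResistanceOnset

/-!
# Birth skeleton (BC3) for crux `ResistanceOnset.LowTFourier`
(item `stmt-AtomisticToContinuum-13484`, route `route-AtomisticToContinuum-ResistanceOnset`, sub-problem
`FouriersLaw`; registrar `planner-skel-stmt-AtomisticToContinuum-13484-0`, 2026-08-17)

Crux (FIXED, concluded BY NAME below): LOW-TEMPERATURE FOURIER LAW for `pinnedChain ω₂ lam β γ`
(all `> 0`): there is `T₀ > 0` such that at every `T ∈ (0,T₀)` some `k > 0` is the common limit of the
finite-`N` responses `D_N(T) = lim_{δ→0} totalCurrent(μ_{N,T+δ/2,T−δ/2})/δ` of every steady-state family.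

## Line `birth` — KINETIC WINDOW CERTIFICATE × T-UNIFORM SERIES LAW × LOW-T CONDUCTANCE FLOOR (Fekete)

This is the route's own declared two-layer engine for its low-temperature half ("LowTUniformSeriesLaw →
FeketeCertificateGlue → WindowToLowTFourier", route header TWO-LAYER PLAN), typed and composed:

* `stub_kineticWindow` — VERBATIM the route's rank-3 crux `KineticWindowResistance`
  (item stmt-AtomisticToContinuum-13486): along the kinetic window `N = ⌈x/T²⌉` the resistance
  `R_N(T) := (N−1)/D_N(T)` has a scaling limit `ρ(x)` as `T → 0⁺`, asymptotically Ohmic, `ρ(x)/x → r > 0`.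
  Role here: the NON-BALLISTIC CERTIFICATE — for every threshold `K` there are one `x` and one `T₁ > 0`
  with `R_{⌈x/T²⌉}(T) > K` for ALL `T ∈ (0,T₁)` (`window_certificate`, real analysis, proved).  Size: open problem.
* `stub_uniformSeriesLaw` — T-UNIFORM SERIES LAW AT LOW TEMPERATURE (the route's declared wall, made
  quantitative; new statement): there are `T₀ > 0` and ONE constant `C` such that at every `T ∈ (0,T₀)` the
  resistances of the finite-`N` responses are superadditive up to `C` on `{N, M ≥ 2}`:
  `R_N + R_M − C ≤ R_{N+M}`.  It is `JunctionLocality.SuperadditiveResistance` (stmt-11748, `C = C(T)`)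
  with the constant UNIFORM on an initial temperature interval — exactly what lets a certificate obtained at
  ONE window length beat the defect as `T → 0⁺`; the positivity antecedent of 11748 is dropped because
  `D_N > 0` (`N ≥ 2`) is a theorem in tree (`…TwoScaleGluingLogRigidity.Stubs.stub_positiveConductance`).
  NOT a consequence of the crux (it carries the bounded finite-size defect): the bet.  Size XL (hardest stub).
* `stub_lowTConductanceFloor` — LOW-TEMPERATURE CONDUCTANCE FLOOR (non-insulation; new statement, the
  low-`T` restriction of `JunctionLocality.ConductanceLowerBound`, stmt-11749): there is `T₀ > 0` such that at
  every `T ∈ (0,T₀)`, `D_N(T) ≥ c(T) > 0` for all large `N`.  A CONSEQUENCE of the crux (`D_N → k > 0`), strictly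
  weaker; in the composition it caps the Fekete slopes (`R_N/N ≤ 1/c`), i.e. excludes the insulator branch
  `R_N/N → +∞` that superadditivity alone allows.  Size L–XL.
* COMPOSITION `LowTFourier_of = lowTFourier_of_series_floor_window stub_uniformSeriesLaw stub_lowTConductanceFloor
  stub_kineticWindow`, the implication sorry-free (axioms standard): fix the parameters; weak-NESS uniqueness is the
  landed `ResistanceOnset.NessUnique_holds` and response existence the landed
  `Theorems.FourierGreenKubo.finiteResponse_of_unique` (items 0741, 0717), so along a canonical steady-state
  family the response function `D₀ N T` exists; take `T* = min(T₀^series, T₀^floor, T₁^window(C), 1)`.  At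
  `T < T*`: `a_N := R_N − C` is superadditive on `{N ≥ 2}` with slopes bounded by the floor, so Fekete on the
  index semigroup `{n ≥ 2}` (`tendsto_div_of_superadditive`, ported from the tree's
  `boundedResponseConverges_tendsto_div_of_superadditive`) gives `a_N/N → ℓ = sup`; the window length
  `N₀ = ⌈x/T²⌉ ≥ 2` has `R_{N₀} > C`, so `ℓ ≥ a_{N₀}/N₀ > 0`; hence `R_N/N → ℓ ∈ (0,∞)` and
  `D_N = ((N−1)/N)/(R_N/N) → 1/ℓ =: k(T) > 0` (`tendsto_response_of_resistance`, valid through the junk value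
  `x/0 = 0`); uniqueness transports the `δ`-limits to every steady-state family (quotients agree for `|δ| < 2T`).
  About 60 lines of instantiation + 150 lines of real analysis — not a one-line seam.

Hardest stub: `stub_uniformSeriesLaw` (no junction-repair / insertion-cost bound is known for a deterministic
anharmonic bulk, let alone uniformly as `T → 0⁺` across the three length regimes `N ≪ T⁻² ≪ ℓ₂ ≍ T^(−2p)` of
HuveneersLukkarinen2020; the route's bet: thermal end-walls slave the phonon chemical potential, so the
resistance defect stays bounded).  `stub_kineticWindow` is the route's spine (stationary boundary-driven
anharmonic kinetic limit at full kinetic times: open, VassilevWu2026 reaches `t ≲ T_kin^(2/3)`).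
Why the cut is not a costume: the window stub alone fixes `R_N` only at ONE length per temperature (no
`N → ∞` statement at fixed `T`); the series law alone allows the insulator `R_N/N → ∞` and, at the harmonic
corner where it holds with `R_N` bounded, the ballistic branch; the floor alone is implied by the crux and
says nothing about convergence.  Each of the three is load-bearing (certificate / structure /
slope cap) and each is a hypothesis of `lowTFourier_of_series_floor_window`.  BC3 probes
`stub → LowTFourier` and `stub → FouriersLaw` by `first | exact? | simpa | aesop` FAIL for all three stubs
(planner folder `bc/probe_*.lean`, verdicts quoted in `Lines/birth.md`).
Disproof used: none on file (`ledger crux ls stmt-AtomisticToContinuum-13484`: no `Disproof.lean`, no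
`Negative/` lemma, 2026-08-17); negatives index (20 refuted statements, 2 in FouriersLaw: OddCorrectorDecay,
FarFieldGaussianity) — none is a series law, a conductance floor or a window law.
-/

noncomputable section

namespace Summit.AtomisticToContinuum.FouriersLaw.Cruxes.LowTFourier

namespace Birth

open Filter Topology

/-! ## The three registered stubs -/

/-- **stub 1 — `stub_kineticWindow` (KINETIC FINITE-SIZE SCALING OF THE RESISTANCE; verbatim the route crux
`ResistanceOnset.KineticWindowResistance`, item stmt-AtomisticToContinuum-13486).**  Under weak-NESS
uniqueness, for every steady-state family and every response function `D` of `pinnedChain ω₂ lam β γ`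
(all `> 0`) there are `ρ : ℝ → ℝ` and `r > 0` with `(⌈x/T²⌉−1)/D ⌈x/T²⌉ T → ρ x` as `T → 0⁺` for every
`x > 0`, and `ρ x / x → r` as `x → ∞`.  [AokiLukkarinenSpohn2006 §3; Spohn2006PhononBoltzmann §17;
VassilevWu2026 Thm 1.1] -/
theorem stub_kineticWindow :
    ∀ ω₂ lam β γ : ℝ, 0 < ω₂ → 0 < lam → 0 < β → 0 < γ → (∀ (N : ℕ) (T_L T_R : ℝ), 0 < T_L → 0 < T_R → ∀ μ ν : MeasureTheory.Measure (Literature.MathematicalPhysics.KineticTheory.HeatConduction.PhaseSpace N), (Literature.MathematicalPhysics.KineticTheory.HeatConduction.pinnedChain ω₂ lam β γ).IsSteadyState N T_L T_R μ → (Literature.MathematicalPhysics.KineticTheory.HeatConduction.pinnedChain ω₂ lam β γ).IsSteadyState N T_L T_R ν → μ = ν) → ∀ μ : (N : ℕ) → ℝ → ℝ → MeasureTheory.Measure (Literature.MathematicalPhysics.KineticTheory.HeatConduction.PhaseSpace N), (∀ (N : ℕ) (T_L T_R : ℝ), 0 < T_L → 0 < T_R → (Literature.MathematicalPhysics.KineticTheory.HeatConduction.pinnedChain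 ω₂ lam β γ).IsSteadyState N T_L T_R (μ N T_L T_R)) → ∀ D : ℕ → ℝ → ℝ, (∀ T : ℝ, 0 < T → ∀ N : ℕ, Filter.Tendsto (fun δ : ℝ => (Literature.MathematicalPhysics.KineticTheory.HeatConduction.pinnedChain ω₂ lam β γ).totalCurrent (μ N (T + δ / 2) (T - δ / 2)) / δ) (nhdsWithin 0 {(0 : ℝ)}ᶜ) (nhds (D N T))) → ∃ ρ : ℝ → ℝ, ∃ r : ℝ, 0 < r ∧ (∀ x : ℝ, 0 < x → Filter.Tendsto (fun T : ℝ => ((⌈x / T ^ 2⌉₊ - 1 : ℕ) : ℝ) / D ⌈x / T ^ 2⌉₊ T) (nhdsWithin 0 (Set.Ioi 0)) (nhds (ρ x))) ∧ Filter.Tendsto (fun x : ℝ => ρ x / x) Filter.atTop (nhds r) := by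
  sorry

/-- **stub 2 — `stub_uniformSeriesLaw` (T-UNIFORM SERIES LAW FOR THE RESISTANCE AT LOW TEMPERATURE).**
Under weak-NESS uniqueness, for every steady-state family of `pinnedChain ω₂ lam β γ` (all `> 0`) there are
`T₀ > 0` and a constant `C` such that for every `T ∈ (0,T₀)` and every sequence `D` of response coefficients
at `T`: `(N−1)/D N + (M−1)/D M − C ≤ (N+M−1)/D (N+M)` for all `N, M ≥ 2` — cutting a chain and
re-thermalising the cut costs at most `C` in end-to-end resistance, UNIFORMLY on an initial temperature
interval.  (`JunctionLocality.SuperadditiveResistance`, stmt-11748, is the `T`-pointwise form with a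
positivity antecedent that is now a theorem.)  [Hammersley1988 (Fekete); HuveneersLukkarinen2020 pp. 2–3
(the three regimes the uniformity must cross); AokiLukkarinenSpohn2006 §5] -/
theorem stub_uniformSeriesLaw :
    ∀ ω₂ lam β γ : ℝ, 0 < ω₂ → 0 < lam → 0 < β → 0 < γ → (∀ (N : ℕ) (T_L T_R : ℝ), 0 < T_L → 0 < T_R → ∀ μ ν : MeasureTheory.Measure (Literature.MathematicalPhysics.KineticTheory.HeatConduction.PhaseSpace N), (Literature.MathematicalPhysics.KineticTheory.HeatConduction.pinnedChain ω₂ lam β γ).IsSteadyState N T_L T_R μ → (Literature.MathematicalPhysics.KineticTheory.HeatConduction.pinnedChain ω₂ lam β γ).IsSteadyState N T_L T_R ν → μ = ν) → ∀ μ : (N : ℕ) → ℝ → ℝ → MeasureTheory.Measure (Literature.MathematicalPhysics.KineticTheory.HeatConduction.PhaseSpace N), (∀ (N : ℕ) (T_L T_R : ℝ), 0 < T_L → 0 < T_R → (Literature.MathematicalPhysics.KineticTheory.HeatConduction.pinnedChain ω₂ lam β γ).IsSteadyState N T_L T_R (μ N T_L T_R)) → ∃ T₀ : ℝ, 0 <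 T₀ ∧ ∃ C : ℝ, ∀ T : ℝ, 0 < T → T < T₀ → ∀ D : ℕ → ℝ, (∀ N : ℕ, Filter.Tendsto (fun δ : ℝ => (Literature.MathematicalPhysics.KineticTheory.HeatConduction.pinnedChain ω₂ lam β γ).totalCurrent (μ N (T + δ / 2) (T - δ / 2)) / δ) (nhdsWithin 0 {(0 : ℝ)}ᶜ) (nhds (D N))) → ∀ N M : ℕ, 2 ≤ N → 2 ≤ M → ((N : ℝ) - 1) / D N + ((M : ℝ) - 1) / D M - C ≤ ((N : ℝ) + (M : ℝ) - 1) / D (N + M) := by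
  sorry

/-- **stub 3 — `stub_lowTConductanceFloor` (LOW-TEMPERATURE CONDUCTANCE FLOOR / NON-INSULATION).**
Under weak-NESS uniqueness, for every steady-state family of `pinnedChain ω₂ lam β γ` (all `> 0`) there is
`T₀ > 0` such that for every `T ∈ (0,T₀)` and every sequence `D` of response coefficients at `T` there are
`c > 0` and `N₁` with `c ≤ D N` for all `N ≥ N₁` (`liminf_N D_N(T) > 0`: the cold chain is not a thermal
insulator).  The low-`T` restriction of `JunctionLocality.ConductanceLowerBound` (stmt-11749); necessary for
the crux.  [DeRoeckHuveneers2015 (asymptotic localisation: small, not zero); BernardinOlla2005;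
BonettoLebowitzReyBellet2000 §6] -/
theorem stub_lowTConductanceFloor :
    ∀ ω₂ lam β γ : ℝ, 0 < ω₂ → 0 < lam → 0 < β → 0 < γ → (∀ (N : ℕ) (T_L T_R : ℝ), 0 < T_L → 0 < T_R → ∀ μ ν : MeasureTheory.Measure (Literature.MathematicalPhysics.KineticTheory.HeatConduction.PhaseSpace N), (Literature.MathematicalPhysics.KineticTheory.HeatConduction.pinnedChain ω₂ lam β γ).IsSteadyState N T_L T_R μ → (Literature.MathematicalPhysics.KineticTheory.HeatConduction.pinnedChain ω₂ lam β γ).IsSteadyState N T_L T_R ν → μ = ν) → ∀ μ : (N : ℕ) → ℝ → ℝ → MeasureTheory.Measure (Literature.MathematicalPhysics.KineticTheory.HeatConduction.PhaseSpace N), (∀ (N : ℕ) (T_L T_R : ℝ), 0 < T_L → 0 < T_R → (Literature.MathematicalPhysics.KineticTheory.HeatConduction.pinnedChain ω₂ lam β γ).IsSteadyState N T_L T_R (μ N T_L T_R)) → ∃ T₀ : ℝ, 0 < T₀ ∧ ∀ T : ℝ, 0 < T → T < T₀ → ∀ D : ℕ → ℝ, (∀ N : ℕ, Filter.Tendsto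 (fun δ : ℝ => (Literature.MathematicalPhysics.KineticTheory.HeatConduction.pinnedChain ω₂ lam β γ).totalCurrent (μ N (T + δ / 2) (T - δ / 2)) / δ) (nhdsWithin 0 {(0 : ℝ)}ᶜ) (nhds (D N))) → ∃ c : ℝ, 0 < c ∧ ∃ N₁ : ℕ, ∀ N : ℕ, N₁ ≤ N → c ≤ D N := by
  sorry

/-! ## Real analysis for the composition (all sorry-free)

Fekete's lemma on the index semigroup `{n ≥ 2}` (ported, with the Euclidean decomposition and the
iteration lemma, from `Theorems/BoundedResponseConverges/Negative/OscillationExcluded.lean` and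
`Theorems/ConductanceLowerBound/Negative/NotInsulatorReduction.lean` so that this skeleton imports only its
route file), the one-certificate positivity of the Fekete limit, the passage resistance-slope → response,
and the extraction of a T-uniform certificate from the window law. -/

/-- Euclidean decomposition adapted to `{n ≥ 2}`: for `n, m ≥ 2`, `n = q m + r` with `2 ≤ r ≤ m + 1`.
[folklore] -/
theorem fekete_decomp {n m : ℕ} (hn : 2 ≤ n) (hm : 2 ≤ m) :
    ∃ q r : ℕ, n = q * m + r ∧ 2 ≤ r ∧ r ≤ m + 1 := by
  refine ⟨(n - 2) / m, 2 + (n - 2) % m, ?_, by omega, ?_⟩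
  · have h := Nat.div_add_mod (n - 2) m
    have h' : (n - 2) / m * m + (2 + (n - 2) % m) = m * ((n - 2) / m) + (n - 2) % m + 2 := by ring
    omega
  · have : (n - 2) % m < m := Nat.mod_lt _ (by omega)
    omega

/-- Fekete iteration for a sequence superadditive on `{n ≥ 2}`: `k·a n + a r ≤ a (k n + r)` (`n, r ≥ 2`).
[folklore] -/
theorem iter_superadditive {a : ℕ → ℝ}
    (h : ∀ n m : ℕ, 2 ≤ n → 2 ≤ m → a n + a m ≤ a (n + m))
    {n r : ℕ} (hn : 2 ≤ n) (hr : 2 ≤ r) : ∀ k : ℕ, (k : ℝ) * a n + a r ≤ a (k * n + r)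
  | 0 => by simp
  | k + 1 => by
    have ih := iter_superadditive h hn hr k
    have hkr : 2 ≤ k * n + r := le_add_left hr
    have hstep := h (k * n + r) n hkr hn
    have e : (k + 1) * n + r = k * n + r + n := by ring
    rw [e]
    push_cast
    linarith

/-- **Superadditive Fekete lemma on `{n ≥ 2}` with bounded slopes**: if `a (n+m) ≥ a n + a m` for
`n, m ≥ 2` and `a n / n ≤ M` for `n ≥ 2`, then `a n / n` converges to `s = sup_{n ≥ 2} a n / n`, and
`a n / n ≤ s` for all `n ≥ 2`. [folklore] -/
theorem tendsto_div_of_superadditive {a : ℕ → ℝ}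
    (h : ∀ n m : ℕ, 2 ≤ n → 2 ≤ m → a n + a m ≤ a (n + m))
    {M : ℝ} (hM : ∀ n : ℕ, 2 ≤ n → a n / n ≤ M) :
    ∃ s : ℝ, Tendsto (fun n : ℕ => a n / n) atTop (𝓝 s) ∧ ∀ n : ℕ, 2 ≤ n → a n / n ≤ s := by
  -- the sup over `n ≥ 2`
  set S : Set ℝ := (fun n : ℕ => a n / n) '' {n : ℕ | 2 ≤ n} with hS
  have hSne : S.Nonempty :=
    ⟨_, Set.mem_image_of_mem _ (show (2 : ℕ) ∈ {n : ℕ | 2 ≤ n} from le_refl 2)⟩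
  have hSbdd : BddAbove S := ⟨M, by
    rintro _ ⟨n, hn, rfl⟩
    exact hM n hn⟩
  set s := sSup S with hs
  have hle : ∀ n : ℕ, 2 ≤ n → a n / n ≤ s := fun n hn => le_csSup hSbdd ⟨n, hn, rfl⟩
  refine ⟨s, ?_, hle⟩
  rw [Metric.tendsto_atTop]
  intro ε hε
  -- a good scale `m ≥ 2` with `a m / m > s - ε/2`
  obtain ⟨_, ⟨m, hm', rfl⟩, hmgt⟩ := exists_lt_of_lt_csSup hSne (by linarith : s - ε / 2 < s)
  have hm : 2 ≤ m := hm'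
  have hm0 : (0 : ℝ) < m := by exact_mod_cast (by omega : 0 < m)
  set A := a m / m with hA
  -- error constant `K ≥ r |A| + |a r|` for every `r ≤ m + 1`
  set K : ℝ := ((m : ℝ) + 1) * |A| + ∑ r ∈ Finset.range (m + 2), |a r| with hK
  have hK0 : 0 ≤ K := by positivity
  -- choose `N₀` with `K / n < ε / 2` for `n ≥ N₀`
  obtain ⟨N₀, hN₀⟩ := exists_nat_gt (2 * K / ε)
  refine ⟨max N₀ 2, fun n hn => ?_⟩
  have hn2 : 2 ≤ n := le_of_max_le_right hn
  have hnN : N₀ ≤ n := le_of_max_le_left hn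
  have hn0 : (0 : ℝ) < n := by exact_mod_cast (by omega : 0 < n)
  -- decompose `n = q m + r`
  obtain ⟨q, r, hnqr, hr2, hrm⟩ := fekete_decomp hn2 hm
  have hiter := iter_superadditive h hm hr2 q
  rw [← hnqr] at hiter
  -- `q * a m = (n - r) * A`
  have hqm : (q : ℝ) * m = n - r := by
    have : ((q * m + r : ℕ) : ℝ) = n := by rw [hnqr]
    push_cast at this
    linarith
  have ham : a m = m * A := by
    rw [hA]; field_simp
  have hmain : (n : ℝ) * A - ((r : ℝ) * |A| + |a r|) ≤ a n := by
    have h1 : (q : ℝ) * a m = ((n : ℝ) - r) * A := by rw [ham, ← mul_assoc, hqm]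
    have h2 : (r : ℝ) * A ≤ (r : ℝ) * |A| := mul_le_mul_of_nonneg_left (le_abs_self _) (by positivity)
    have h3 : -a r ≤ |a r| := neg_le_abs _
    nlinarith [hiter, h1, h2, h3]
  have hrle : (r : ℝ) ≤ m + 1 := by exact_mod_cast hrm
  have hKr : (r : ℝ) * |A| + |a r| ≤ K := by
    have h1 : (r : ℝ) * |A| ≤ ((m : ℝ) + 1) * |A| := mul_le_mul_of_nonneg_right hrle (abs_nonneg _)
    have h2 : |a r| ≤ ∑ r ∈ Finset.range (m + 2), |a r| :=
      Finset.single_le_sum (f := fun r => |a r|) (fun i _ => abs_nonneg _)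
        (Finset.mem_range.2 (by omega))
    linarith
  -- lower bound `a n / n ≥ A - K / n`
  have hlow : A - K / n ≤ a n / n := by
    rw [le_div_iff₀ hn0, sub_mul, div_mul_cancel₀ _ hn0.ne']
    linarith
  -- `K / n < ε / 2`
  have hKn : K / n < ε / 2 := by
    have hN₀' : 2 * K / ε < n := lt_of_lt_of_le hN₀ (by exact_mod_cast hnN)
    rw [div_lt_iff₀ hn0]
    rw [div_lt_iff₀ hε] at hN₀'
    linarith
  have hup := hle n hn2
  rw [Real.dist_eq, abs_lt]
  constructor <;> linarith

/-- **Fekete with ONE certificate.** If `R` is superadditive up to `C` on `{N, M ≥ 2}`, the slopes `R N / N`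
are bounded above on `{N ≥ 2}`, and a single length `N₀ ≥ 2` has `C < R N₀`, then `R N / N → ℓ` for some
`ℓ > 0` (`ℓ = sup_{N ≥ 2} (R N − C)/N ≥ (R N₀ − C)/N₀ > 0`). [folklore] -/
theorem tendsto_resistance_div_of_certificate {R : ℕ → ℝ} {C B : ℝ}
    (hsup : ∀ N M : ℕ, 2 ≤ N → 2 ≤ M → R N + R M - C ≤ R (N + M))
    (hB : ∀ N : ℕ, 2 ≤ N → R N / N ≤ B)
    {N₀ : ℕ} (hN₀ : 2 ≤ N₀) (hcert : C < R N₀) :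
    ∃ ℓ : ℝ, 0 < ℓ ∧ Tendsto (fun N : ℕ => R N / N) atTop (𝓝 ℓ) := by
  have hsa : ∀ n m : ℕ, 2 ≤ n → 2 ≤ m → (R n - C) + (R m - C) ≤ (R (n + m) - C) := by
    intro n m hn hm
    have := hsup n m hn hm
    linarith
  have hslope : ∀ n : ℕ, 2 ≤ n → (R n - C) / n ≤ B + |C| := by
    intro n hn
    have hn0 : (0 : ℝ) < n := by exact_mod_cast (by omega : 0 < n)
    have h1n : (1 : ℝ) ≤ n := by exact_mod_cast (by omega : 1 ≤ n)
    rw [sub_div]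
    have h2 : |C / n| ≤ |C| := by
      rw [abs_div, abs_of_pos hn0]
      exact div_le_self (abs_nonneg C) h1n
    have h3 := neg_abs_le (C / n)
    have h4 := hB n hn
    linarith
  obtain ⟨s, hs, hle⟩ := tendsto_div_of_superadditive (a := fun N => R N - C) hsa hslope
  have hN₀0 : (0 : ℝ) < N₀ := by exact_mod_cast (by omega : 0 < N₀)
  have hs0 : 0 < s := by
    have h1 : 0 < (R N₀ - C) / N₀ := div_pos (by linarith) hN₀0
    exact lt_of_lt_of_le h1 (hle N₀ hN₀)
  refine ⟨s, hs0, ?_⟩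
  have hC : Tendsto (fun N : ℕ => C / (N : ℝ)) atTop (𝓝 0) :=
    tendsto_const_nhds.div_atTop tendsto_natCast_atTop_atTop
  have hsum := hs.add hC
  rw [add_zero] at hsum
  refine hsum.congr' (Eventually.of_forall fun N => ?_)
  show (R N - C) / N + C / N = R N / N
  ring

/-- **From the resistance slope back to the response**: if `((N−1)/D N)/N → ℓ > 0` then `D N → 1/ℓ`,
because for `N ≥ 2` one has `D N = ((N−1)/N) / (((N−1)/D N)/N)` identically (also through the junk value
`x / 0 = 0`). [folklore] -/
theorem tendsto_response_of_resistance {D : ℕ → ℝ} {ℓ : ℝ} (hℓ : 0 < ℓ)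
    (h : Tendsto (fun N : ℕ => ((N : ℝ) - 1) / D N / N) atTop (𝓝 ℓ)) :
    Tendsto D atTop (𝓝 (1 / ℓ)) := by
  have h1 : Tendsto (fun N : ℕ => ((N : ℝ) - 1) / N) atTop (𝓝 1) := by
    have h0 : Tendsto (fun N : ℕ => (1 : ℝ) - 1 / (N : ℝ)) atTop (𝓝 (1 - 0)) :=
      tendsto_const_nhds.sub tendsto_one_div_atTop_nhds_zero_nat
    rw [sub_zero] at h0
    refine h0.congr' ?_
    filter_upwards [eventually_ge_atTop 1] with N hN
    have hN0 : (N : ℝ) ≠ 0 := by exact_mod_cast (by omega : N ≠ 0)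
    field_simp
  have h2 := h1.div h hℓ.ne'
  refine h2.congr' ?_
  filter_upwards [eventually_ge_atTop 2] with N hN
  have hN0 : (N : ℝ) ≠ 0 := by exact_mod_cast (by omega : N ≠ 0)
  have hN1 : (N : ℝ) - 1 ≠ 0 := by
    have : (2 : ℝ) ≤ N := by exact_mod_cast hN
    exact ne_of_gt (by linarith)
  show ((N : ℝ) - 1) / N / (((N : ℝ) - 1) / D N / N) = D N
  rw [div_right_comm ((N : ℝ) - 1) (D N) N, div_div_cancel₀ (div_ne_zero hN1 hN0)]

/-- **The window certificate** (real analysis): if `F x T → ρ x` as `T → 0⁺` for every `x > 0` and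
`ρ x / x → r > 0` as `x → ∞`, then every threshold `K` is beaten T-UNIFORMLY near `0` at one window
parameter: there are `x ≥ 1` and `T₁ > 0` with `K < F x T` for all `T ∈ (0, T₁)`. [folklore] -/
theorem window_certificate {F : ℝ → ℝ → ℝ} {ρ : ℝ → ℝ} {r : ℝ} (hr : 0 < r)
    (hρ : ∀ x : ℝ, 0 < x → Tendsto (fun T : ℝ => F x T) (nhdsWithin 0 (Set.Ioi 0)) (𝓝 (ρ x)))
    (hρr : Tendsto (fun x : ℝ => ρ x / x) atTop (𝓝 r)) (K : ℝ) :
    ∃ x : ℝ, 1 ≤ x ∧ ∃ T₁ : ℝ, 0 < T₁ ∧ ∀ T : ℝ, 0 < T → T < T₁ → K < F x T := by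
  -- a large `x ≥ 1` with `ρ x / x > r / 2` and `(r/2)·x > |K|`
  have hev : ∀ᶠ x in atTop, r / 2 < ρ x / x := hρr.eventually (eventually_gt_nhds (by linarith))
  obtain ⟨x, hx1, hxK, hxr⟩ := ((eventually_ge_atTop (1 : ℝ)).and
    ((eventually_gt_atTop (2 * |K| / r)).and hev)).exists
  have hx0 : 0 < x := by linarith
  have hρx : K < ρ x := by
    have h1 : r / 2 * x < ρ x := (lt_div_iff₀ hx0).mp hxr
    have h2 : 2 * |K| < x * r := (div_lt_iff₀ hr).mp hxK
    have h3 : K ≤ |K| := le_abs_self K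
    nlinarith
  -- then `K < F x T` on a right-neighbourhood `(0, T₁)` of `0`
  have hevT : ∀ᶠ T in nhdsWithin 0 (Set.Ioi 0), K < F x T := (hρ x hx0).eventually (eventually_gt_nhds hρx)
  obtain ⟨T₁, hT₁, hsub⟩ := mem_nhdsGT_iff_exists_Ioo_subset.mp hevT
  exact ⟨x, hx1, T₁, hT₁, fun T hT hTlt => hsub ⟨hT, hTlt⟩⟩

/-! ## The composition -/

/-- **The implication, sorry-free** (axioms `propext`, `Classical.choice`, `Quot.sound`):
`stub_uniformSeriesLaw`-statement → `stub_lowTConductanceFloor`-statement → `stub_kineticWindow`-statement →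
the statement of `ResistanceOnset.LowTFourier` (conclusion = the crux's definiens VERBATIM, so that
`LowTFourier_of` below is this term at the crux's name).  Landed inputs: `ResistanceOnset.NessUnique_holds`
(item 0741) and `Theorems.FourierGreenKubo.finiteResponse_of_unique` (item 0717). -/
theorem lowTFourier_of_series_floor_window :
    (∀ ω₂ lam β γ : ℝ, 0 < ω₂ → 0 < lam → 0 < β → 0 < γ → (∀ (N : ℕ) (T_L T_R : ℝ), 0 < T_L → 0 < T_R → ∀ μ ν : MeasureTheory.Measure (Literature.MathematicalPhysics.KineticTheory.HeatConduction.PhaseSpace N), (Literature.MathematicalPhysics.KineticTheory.HeatConduction.pinnedChain ω₂ lam β γ).IsSteadyState N T_L T_R μ → (Literature.MathematicalPhysics.KineticTheory.HeatConduction.pinnedChain ω₂ lam β γ).IsSteadyState N T_L T_R ν → μ = ν) → ∀ μ : (N : ℕ) → ℝ → ℝ → MeasureTheory.Measure (Literature.MathematicalPhysics.KineticTheory.HeatConduction.PhaseSpace N), (∀ (N : ℕ) (T_L T_R : ℝ), 0 < T_L → 0 < T_R → (Literature.MathematicalPhysics.KineticTheory.HeatConduction.pinnedChain ω₂ lam β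 γ).IsSteadyState N T_L T_R (μ N T_L T_R)) → ∃ T₀ : ℝ, 0 < T₀ ∧ ∃ C : ℝ, ∀ T : ℝ, 0 < T → T < T₀ → ∀ D : ℕ → ℝ, (∀ N : ℕ, Filter.Tendsto (fun δ : ℝ => (Literature.MathematicalPhysics.KineticTheory.HeatConduction.pinnedChain ω₂ lam β γ).totalCurrent (μ N (T + δ / 2) (T - δ / 2)) / δ) (nhdsWithin 0 {(0 : ℝ)}ᶜ) (nhds (D N))) → ∀ N M : ℕ, 2 ≤ N → 2 ≤ M → ((N : ℝ) - 1) / D N + ((M : ℝ) - 1) / D M - C ≤ ((N : ℝ) + (M : ℝ) - 1) / D (N + M)) →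
    (∀ ω₂ lam β γ : ℝ, 0 < ω₂ → 0 < lam → 0 < β → 0 < γ → (∀ (N : ℕ) (T_L T_R : ℝ), 0 < T_L → 0 < T_R → ∀ μ ν : MeasureTheory.Measure (Literature.MathematicalPhysics.KineticTheory.HeatConduction.PhaseSpace N), (Literature.MathematicalPhysics.KineticTheory.HeatConduction.pinnedChain ω₂ lam β γ).IsSteadyState N T_L T_R μ → (Literature.MathematicalPhysics.KineticTheory.HeatConduction.pinnedChain ω₂ lam β γ).IsSteadyState N T_L T_R ν → μ = ν) → ∀ μ : (N : ℕ) → ℝ → ℝ → MeasureTheory.Measure (Literature.MathematicalPhysics.KineticTheory.HeatConduction.PhaseSpace N), (∀ (N : ℕ) (T_L T_R : ℝ), 0 < T_L → 0 < T_R → (Literature.MathematicalPhysics.KineticTheory.HeatConduction.pinnedChain ω₂ lam β γ).IsSteadyState N T_L T_R (μ N T_L T_R)) → ∃ T₀ : ℝ, 0 < T₀ ∧ ∀ T : ℝ, 0 < T → T < T₀ → ∀ D : ℕ → ℝ, (∀ N : ℕ, Filter.Tendsto (fun δ : ℝ => (Literature.MathematicalPhysics.KineticTheory.HeatConduction.pinnedChain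 ω₂ lam β γ).totalCurrent (μ N (T + δ / 2) (T - δ / 2)) / δ) (nhdsWithin 0 {(0 : ℝ)}ᶜ) (nhds (D N))) → ∃ c : ℝ, 0 < c ∧ ∃ N₁ : ℕ, ∀ N : ℕ, N₁ ≤ N → c ≤ D N) →
    (∀ ω₂ lam β γ : ℝ, 0 < ω₂ → 0 < lam → 0 < β → 0 < γ → (∀ (N : ℕ) (T_L T_R : ℝ), 0 < T_L → 0 < T_R → ∀ μ ν : MeasureTheory.Measure (Literature.MathematicalPhysics.KineticTheory.HeatConduction.PhaseSpace N), (Literature.MathematicalPhysics.KineticTheory.HeatConduction.pinnedChain ω₂ lam β γ).IsSteadyState N T_L T_R μ → (Literature.MathematicalPhysics.KineticTheory.HeatConduction.pinnedChain ω₂ lam β γ).IsSteadyState N T_L T_R ν → μ = ν) → ∀ μ : (N : ℕ) → ℝ → ℝ → MeasureTheory.Measure (Literature.MathematicalPhysics.KineticTheory.HeatConduction.PhaseSpace N), (∀ (N : ℕ) (T_L T_R : ℝ), 0 < T_L → 0 < T_R → (Literature.MathematicalPhysics.KineticTheory.HeatConduction.pinnedChain ω₂ lam β γ).IsSteadyState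 N T_L T_R (μ N T_L T_R)) → ∀ D : ℕ → ℝ → ℝ, (∀ T : ℝ, 0 < T → ∀ N : ℕ, Filter.Tendsto (fun δ : ℝ => (Literature.MathematicalPhysics.KineticTheory.HeatConduction.pinnedChain ω₂ lam β γ).totalCurrent (μ N (T + δ / 2) (T - δ / 2)) / δ) (nhdsWithin 0 {(0 : ℝ)}ᶜ) (nhds (D N T))) → ∃ ρ : ℝ → ℝ, ∃ r : ℝ, 0 < r ∧ (∀ x : ℝ, 0 < x → Filter.Tendsto (fun T : ℝ => ((⌈x / T ^ 2⌉₊ - 1 : ℕ) : ℝ) / D ⌈x / T ^ 2⌉₊ T) (nhdsWithin 0 (Set.Ioi 0)) (nhds (ρ x))) ∧ Filter.Tendsto (fun x : ℝ => ρ x / x) Filter.atTop (nhds r)) →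
    (∀ ω₂ lam β γ : ℝ, 0 < ω₂ → 0 < lam → 0 < β → 0 < γ → ∃ T₀ : ℝ, 0 < T₀ ∧ ∀ T : ℝ, 0 < T → T < T₀ → ∃ k : ℝ, 0 < k ∧ ∀ μ : (N : ℕ) → ℝ → ℝ → MeasureTheory.Measure (Literature.MathematicalPhysics.KineticTheory.HeatConduction.PhaseSpace N), (∀ (N : ℕ) (T_L T_R : ℝ), 0 < T_L → 0 < T_R → (Literature.MathematicalPhysics.KineticTheory.HeatConduction.pinnedChain ω₂ lam β γ).IsSteadyState N T_L T_R (μ N T_L T_R)) → ∃ D : ℕ → ℝ, (∀ N : ℕ, Filter.Tendsto (fun δ : ℝ => (Literature.MathematicalPhysics.KineticTheory.HeatConduction.pinnedChain ω₂ lam β γ).totalCurrent (μ N (T + δ / 2) (T - δ / 2)) / δ) (nhdsWithin 0 {(0 : ℝ)}ᶜ) (nhds (D N))) ∧ Filter.Tendsto D Filter.atTop (nhds k)) := by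
  intro hS hF hW ω₂ lam β γ hω hl hβ hγ
  have huniq := _root_.Summit.AtomisticToContinuum.FouriersLaw.Theses.ResistanceOnset.NessUnique_holds
    ω₂ lam β γ hω hl hβ hγ
  classical
  by_cases hex : ∃ μ₀ : (N : ℕ) → ℝ → ℝ →
      MeasureTheory.Measure (Literature.MathematicalPhysics.KineticTheory.HeatConduction.PhaseSpace N),
      ∀ (N : ℕ) (T_L T_R : ℝ), 0 < T_L → 0 < T_R →
        (Literature.MathematicalPhysics.KineticTheory.HeatConduction.pinnedChain ω₂ lam β γ).IsSteadyState
          N T_L T_R (μ₀ N T_L T_R)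
  swap
  · -- no steady-state family at all: the crux is vacuous at these parameters
    exact ⟨1, one_pos, fun T _ _ => ⟨1, one_pos, fun μ hμ => (hex ⟨μ, hμ⟩).elim⟩⟩
  obtain ⟨μ₀, hμ₀⟩ := hex
  -- the response function along the canonical family `μ₀` (item 0717, landed)
  have hDex := _root_.Summit.AtomisticToContinuum.FouriersLaw.Theorems.FourierGreenKubo.finiteResponse_of_unique
    ω₂ lam β γ hω hl hβ hγ huniq μ₀ hμ₀
  choose Dp hDp using hDex
  let D₀ : ℕ → ℝ → ℝ := fun N T => if hT : 0 < T then Dp T hT N else 0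
  have hD₀ : ∀ T : ℝ, 0 < T → ∀ N : ℕ, Tendsto (fun δ : ℝ =>
      (Literature.MathematicalPhysics.KineticTheory.HeatConduction.pinnedChain ω₂ lam β γ).totalCurrent
        (μ₀ N (T + δ / 2) (T - δ / 2)) / δ) (nhdsWithin 0 {(0 : ℝ)}ᶜ) (𝓝 (D₀ N T)) := by
    intro T hT N
    simp only [D₀, dif_pos hT]
    exact hDp T hT N
  -- the three stubs along `μ₀`, `D₀`
  obtain ⟨T₁, hT₁, C, hC⟩ := hS ω₂ lam β γ hω hl hβ hγ huniq μ₀ hμ₀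
  obtain ⟨T₂, hT₂, hfloor⟩ := hF ω₂ lam β γ hω hl hβ hγ huniq μ₀ hμ₀
  obtain ⟨ρ, r, hr, hρ, hρr⟩ := hW ω₂ lam β γ hω hl hβ hγ huniq μ₀ hμ₀ D₀ hD₀
  -- the window certificate beats the T-uniform defect `C`
  obtain ⟨x, hx1, T₃, hT₃, hcert⟩ :=
    window_certificate (F := fun x T => ((⌈x / T ^ 2⌉₊ - 1 : ℕ) : ℝ) / D₀ ⌈x / T ^ 2⌉₊ T) hr hρ hρr C
  refine ⟨min (min T₁ T₂) (min T₃ 1), lt_min (lt_min hT₁ hT₂) (lt_min hT₃ one_pos), fun T hT hTlt => ?_⟩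
  have hTT₁ : T < T₁ := lt_of_lt_of_le hTlt ((min_le_left _ _).trans (min_le_left _ _))
  have hTT₂ : T < T₂ := lt_of_lt_of_le hTlt ((min_le_left _ _).trans (min_le_right _ _))
  have hTT₃ : T < T₃ := lt_of_lt_of_le hTlt ((min_le_right _ _).trans (min_le_left _ _))
  have hT1 : T < 1 := lt_of_lt_of_le hTlt ((min_le_right _ _).trans (min_le_right _ _))
  -- superadditivity of the resistances `R N = (N-1)/D₀ N T` up to `C`, at this temperature
  have hsup : ∀ N M : ℕ, 2 ≤ N → 2 ≤ M →
      ((N : ℝ) - 1) / D₀ N T + (((M : ℝ) - 1) / D₀ M T) - C ≤ (((N + M : ℕ) : ℝ) - 1) / D₀ (N + M) T := by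
    intro N M hN hM
    have h := hC T hT hTT₁ (fun N => D₀ N T) (hD₀ T hT) N M hN hM
    push_cast
    exact h
  -- the conductance floor caps the slopes `R N / N`
  obtain ⟨c, hc, N₁, hN₁⟩ := hfloor T hT hTT₂ (fun N => D₀ N T) (hD₀ T hT)
  have hB : ∀ N : ℕ, 2 ≤ N → ((N : ℝ) - 1) / D₀ N T / N ≤
      (∑ n ∈ Finset.range N₁, |((n : ℝ) - 1) / D₀ n T / n|) + 1 / c := by
    intro N hN
    have hN0 : (0 : ℝ) < N := by exact_mod_cast (by omega : 0 < N)
    have h0 : (0 : ℝ) ≤ ∑ n ∈ Finset.range N₁, |((n : ℝ) - 1) / D₀ n T / n| :=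
      Finset.sum_nonneg fun i _ => abs_nonneg _
    have h3 : (0 : ℝ) ≤ 1 / c := by positivity
    by_cases hlt : N < N₁
    · have h1 : ((N : ℝ) - 1) / D₀ N T / N ≤ |((N : ℝ) - 1) / D₀ N T / N| := le_abs_self _
      have h2 : |((N : ℝ) - 1) / D₀ N T / N| ≤ ∑ n ∈ Finset.range N₁, |((n : ℝ) - 1) / D₀ n T / n| :=
        Finset.single_le_sum (f := fun n : ℕ => |((n : ℝ) - 1) / D₀ n T / n|) (fun i _ => abs_nonneg _)
          (Finset.mem_range.2 hlt)
      linarith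
    · have hDN : c ≤ D₀ N T := hN₁ N (not_lt.mp hlt)
      have hRle : ((N : ℝ) - 1) / D₀ N T ≤ ((N : ℝ) - 1) / c :=
        div_le_div_of_nonneg_left (by linarith [show (2 : ℝ) ≤ N by exact_mod_cast hN]) hc hDN
      have h4 : ((N : ℝ) - 1) / D₀ N T / N ≤ 1 / c := by
        rw [div_le_iff₀ hN0]
        have h5 : ((N : ℝ) - 1) / c ≤ N / c := div_le_div_of_nonneg_right (by linarith) hc.le
        have e : (N : ℝ) / c = 1 / c * N := by ring
        linarith
      linarith
  -- the certificate length `N₀ = ⌈x / T²⌉ ≥ 2` has resistance `> C`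
  have hT2 : 0 < T ^ 2 := by positivity
  have hN₀2 : 2 ≤ ⌈x / T ^ 2⌉₊ := by
    have h1 : (1 : ℝ) < x / T ^ 2 := by
      rw [lt_div_iff₀ hT2]
      nlinarith
    have h2 := Nat.lt_ceil.mpr (show ((1 : ℕ) : ℝ) < x / T ^ 2 by exact_mod_cast h1)
    omega
  have hcertR : C < ((⌈x / T ^ 2⌉₊ : ℝ) - 1) / D₀ ⌈x / T ^ 2⌉₊ T := by
    have h : C < ((⌈x / T ^ 2⌉₊ - 1 : ℕ) : ℝ) / D₀ ⌈x / T ^ 2⌉₊ T := hcert T hT hTT₃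
    have e : ((⌈x / T ^ 2⌉₊ - 1 : ℕ) : ℝ) = (⌈x / T ^ 2⌉₊ : ℝ) - 1 := by
      rw [Nat.cast_sub (by omega : 1 ≤ ⌈x / T ^ 2⌉₊), Nat.cast_one]
    rw [← e]
    exact h
  -- Fekete with one certificate, then back to the response
  obtain ⟨ℓ, hℓ, hlim⟩ := tendsto_resistance_div_of_certificate
    (R := fun N => ((N : ℝ) - 1) / D₀ N T) hsup hB hN₀2 hcertR
  have hDlim : Tendsto (fun N : ℕ => D₀ N T) atTop (𝓝 (1 / ℓ)) :=
    tendsto_response_of_resistance (D := fun N => D₀ N T) hℓ hlim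
  refine ⟨1 / ℓ, one_div_pos.mpr hℓ, fun μ hμ => ⟨fun N => D₀ N T, fun N => ?_, hDlim⟩⟩
  -- transfer to an arbitrary steady-state family: by uniqueness the quotients agree for `|δ| < 2T`
  refine (hD₀ T hT N).congr' ?_
  have h2 : ∀ᶠ δ in 𝓝 (0 : ℝ), δ < 2 * T := eventually_lt_nhds (by linarith)
  have h2' : ∀ᶠ δ in 𝓝 (0 : ℝ), -(2 * T) < δ := eventually_gt_nhds (by linarith)
  filter_upwards [mem_nhdsWithin_of_mem_nhds h2, mem_nhdsWithin_of_mem_nhds h2'] with δ hlt hgt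
  have ha : 0 < T + δ / 2 := by linarith
  have hb : 0 < T - δ / 2 := by linarith
  rw [huniq N _ _ ha hb (μ₀ N _ _) (μ N _ _) (hμ₀ N _ _ ha hb) (hμ N _ _ ha hb)]

/-- **Skeleton theorem — the crux `ResistanceOnset.LowTFourier` BY NAME from the three registered stubs**
(the only theorem of this file concluding the crux; its `sorry`s are exactly those of `stub_uniformSeriesLaw`,
`stub_lowTConductanceFloor`, `stub_kineticWindow`; the seam is the sorry-free
`lowTFourier_of_series_floor_window`). -/
theorem LowTFourier_of :
    _root_.Summit.AtomisticToContinuum.FouriersLaw.Theses.ResistanceOnset.LowTFourier :=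
  lowTFourier_of_series_floor_window stub_uniformSeriesLaw stub_lowTConductanceFloor stub_kineticWindow

end Birth

end Summit.AtomisticToContinuum.FouriersLaw.Cruxes.LowTFourier

end
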